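import Mathlib.Analysis.Calculus.Deriv.CompMul
import Literature.Geometry.Lorentzian.ConcaveProfile
import Literature.Geometry.Lorentzian.SuperharmonicInvRadius
import Literature.Geometry.Lorentzian.CoordLaplacianChainRule
import Literature.Geometry.Lorentzian.ChartMetricCoord
import Literature.Geometry.Lorentzian.DalembertianNaturality
import Literature.Geometry.Lorentzian.CurvatureSymmetries
import Literature.Geometry.Lorentzian.AsymptoticallyFlatChart
import Literature.Geometry.Lorentzian.PositiveMassConformalProofs
import Literature.Geometry.Lorentzian.ConformalChange
import HarnessLib

/-!
# Schoen–Yau 1979, §2 Step 1: the superharmonic conformal factor, and the discharge of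
# `exists_conformal_scalarPos_of_massNeg`

Schoen–Yau, Comm. Math. Phys. 65 (1979), §2, Step 1 (pp. 48–49). On an asymptotically
Schwarzschildean end of mass `M < 0`: (2.1) `Δ(1/r) < 0` for `r ≥ σ`; (2.2) a concave
nondecreasing profile `ζ` with `ζ(t) = t` for `t ≤ t₀ = -M/8σ` and `ζ` constant for `t ≥ 2t₀`;
*"Define the metric `d̃s² = φ⁴ ds²` on `N`, where `φ(x) = 1 + ζ(-M/4r)` for `x ∈ N_k`, … Since
`-M/4r` is a superharmonic function on `N_k` for `r ≥ σ`, we have (2.3) `Δφ ≤ 0` on `N`,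
`Δφ < 0` for `x ∈ N_k` with `r > 2σ`"*; with the transformation law `R̃ = φ⁻⁵(-8Δφ + Rφ)` this is
Step 1 of the proof of their Theorem 1.

This file constructs `φ` (`AFEnd.syFactor`) and proves (2.3), i.e. exactly the hypothesis `hfac`
of `exists_conformal_scalarPos_of_massNeg_of_ingredients` (`PositiveMassConformalProofs.lean`);
since the other hypothesis `hconf` of that reduction is the proved transformation law
`conformal_scalarCurvature_law` (`ConformalChange.lean`), the named fact
`exists_conformal_scalarPos_of_massNeg` (`PositiveMassSchoenYau.lean`, Step 1) is thereby
**discharged**: `exists_conformal_scalarPos_of_massNeg_holds`.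

## Main results

* `PseudoRiemannianMetric.dalembertian_eq_zero_of_eventuallyEq` — `□_g f (x) = 0` if `f` is
  locally constant at `x`;
* `AFEnd.syFactor e M σ` — `φ(q) = 1 + ζ_{t₀}(κ / max(‖coord q‖, R))`, `κ = -M/4`, `t₀ = κ/2σ`
  (equal to `1 + ζ(-M/4r)` on the end and to the constant `1 + ζ(2t₀)` where `r ≤ σ` and off
  the end); `syFactor_pos`, `syFactor_dataChart`, `syFactor_dataChart_of_lt` (`φ = 1 - M/4r` for
  `r > 2σ`), `contMDiff_syFactor`;
* `AFEnd.dalembertian_syFactor_dataChart` — **(2.3) in the chart**: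
  `Δ_h φ (Φ z) = κ ζ'(κ/r) Δ_G(1/r) + κ² ζ''(κ/r) |∇(1/r)|²_G` with `G = hCoeff e D`
  (`dalembertian_comap`, `OpensChart.dalembertian_eq_lapAt`, `MetricCoord.lapAt_comp`);
* `AFEnd.dalembertian_syFactor_nonpos`, `AFEnd.dalembertian_syFactor_neg` — **(2.3)**:
  `Δφ ≤ 0` on `X`, `Δφ < 0` on `far 2σ`, for `σ` beyond the radius of (2.1)
  (`AFEnd.exists_radius_lapAt_hCoeff_inv_norm_le`, `SuperharmonicInvRadius.lean`);
* `superharmonicFactor_of_massNeg` — the hypothesis `hfac`, proved;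
* `exists_conformal_scalarPos_of_massNeg_holds` — **Step 1 of Schoen–Yau's Theorem 1,
  discharged.**

## References

* R. Schoen, S.-T. Yau, *On the proof of the positive mass conjecture in general relativity*,
  Comm. Math. Phys. 65 (1979) 45–76, §2 Step 1, (2.1)–(2.3), pp. 48–49. [SchoenYauPMT1979]
-/

noncomputable section

set_option maxSynthPendingDepth 3

open Set Filter Bundle Manifold TopologicalSpace Bornology ContinuousLinearMap
open scoped Topology ContDiff Manifold RealInnerProductSpace

namespace Literature.Geometry.Lorentzian

/-! ### The wave operator of a locally constant function vanishes -/

namespace PseudoRiemannianMetric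

variable {E : Type*} [NormedAddCommGroup E] [NormedSpace ℝ E] {H : Type*} [TopologicalSpace H]
  {I : ModelWithCorners ℝ E H} {M : Type*} [TopologicalSpace M] [ChartedSpace H M]
  [IsManifold I ∞ M] {n : ℕ∞ω} [Fact (1 ≤ n)] [FiniteDimensional ℝ E] [CompleteSpace E]
  (g : PseudoRiemannianMetric I n E (TangentSpace I : M → Type _)) [g.HasLeviCivita]

omit [Fact (1 ≤ n)] [FiniteDimensional ℝ E] [CompleteSpace E] in
/-- The bare Hessian operation of a locally constant function vanishes. [folklore] -/
theorem hessianAux_eq_zero_of_eventuallyEq {f : M → ℝ} {x : M} {c : ℝ}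
    (h : f =ᶠ[𝓝 x] fun _ ↦ c) (X Y : Π y : M, TangentSpace I y) :
    g.hessianAux f X Y x = 0 := by
  have hd : ∀ᶠ y in 𝓝 x, mvfderiv I f y = 0 := by
    filter_upwards [h.eventually_nhds] with y hy
    rw [mvfderiv_congr_of_eventuallyEq hy]
    exact mvfderiv_const c
  have h0 : mvfderiv I f x = 0 := hd.self_of_nhds
  have hinner : (fun y ↦ mvfderiv I f y (Y y)) =ᶠ[𝓝 x] fun _ ↦ (0 : ℝ) := by
    filter_upwards [hd] with y hy
    rw [hy]
    rfl
  unfold hessianAux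
  rw [mvfderiv_congr_of_eventuallyEq hinner, mvfderiv_const, h0]
  simp

omit [Fact (1 ≤ n)] [FiniteDimensional ℝ E] [CompleteSpace E] in
/-- **The Hessian of a locally constant function vanishes.** [folklore] -/
theorem hessian_eq_zero_of_eventuallyEq {f : M → ℝ} {x : M} {c : ℝ} (h : f =ᶠ[𝓝 x] fun _ ↦ c) :
    g.hessian f x = 0 :=
  g.hessian_eq_of_forall 0 fun X₀ Y₀ ↦ by
    rw [g.hessianAux_eq_zero_of_eventuallyEq h]
    rfl

omit [Fact (1 ≤ n)] [CompleteSpace E] in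
/-- **The wave / Laplace–Beltrami operator of a locally constant function vanishes.**
[folklore] -/
theorem dalembertian_eq_zero_of_eventuallyEq {f : M → ℝ} {x : M} {c : ℝ}
    (h : f =ᶠ[𝓝 x] fun _ ↦ c) : g.dalembertian f x = 0 := by
  rw [dalembertian, g.hessian_eq_zero_of_eventuallyEq h, PseudoRiemannianMetric.trace,
    LinearMap.comp_zero, map_zero]

end PseudoRiemannianMetric

/-! ### The conformal factor `φ = 1 + ζ(-M/4r)` on `X` -/

namespace AFEnd

variable {X : Type} [TopologicalSpace X] [ChartedSpace E3 X] (e : AFEnd X)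

/-- The positive constant `κ = -M/4` of the superharmonic function `-M/4r = κ/r`. [folklore] -/
def syKappa (M : ℝ) : ℝ := -M / 4

/-- The threshold `t₀ = κ/(2σ) = -M/(8σ)` of the profile (Schoen–Yau 1979, p. 49: `t₀ = -M/8σ`).
[cite: SchoenYauPMT1979, §2 Step 1 (p. 49)] -/
def syT0 (M σ : ℝ) : ℝ := syKappa M / (2 * σ)

/-- **Schoen–Yau's conformal factor** `φ = 1 + ζ(-M/4r)` on the end, extended by the constant
`1 + ζ(2t₀)` (its value where `r ≤ σ`) off the end: `φ(q) = 1 + ζ_{t₀}(κ / max(‖coord q‖, R))`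
with `κ = -M/4`, `t₀ = κ/2σ` (`coord` the coordinate function of the end, `0` off the end, so that
the argument of `ζ` is `κ/R ≥ 2t₀` there when `σ ≥ R`). Schoen–Yau 1979, p. 49: "`φ(x) = 1 +
ζ(-M/4r)` for `x ∈ N_k`, `φ(x) = 1 + 3t₀/2` for `x ∈ N ∼ N_k`" (here the constant is `ζ(2t₀)`).
[cite: SchoenYauPMT1979, §2 Step 1 (p. 49)] -/
def syFactor (M σ : ℝ) (q : X) : ℝ :=
  1 + SchoenYau.concaveProfile (syT0 M σ) (syKappa M * (max ‖e.coord q‖ e.R)⁻¹)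

/-- The chart representative `1 + ζ(κ/‖y‖)` of the factor. [folklore] -/
def syFactorRepr (M σ : ℝ) (y : E3) : ℝ :=
  1 + SchoenYau.concaveProfile (syT0 M σ) (syKappa M * ‖y‖⁻¹)

/-- `κ > 0` for `M < 0`. [folklore] -/
theorem syKappa_pos {M : ℝ} (hM : M < 0) : 0 < syKappa M := by
  unfold syKappa; linarith

/-- `t₀ > 0` for `M < 0`, `σ > 0`. [folklore] -/
theorem syT0_pos {M σ : ℝ} (hM : M < 0) (hσ : 0 < σ) : 0 < syT0 M σ := by
  unfold syT0; exact div_pos (syKappa_pos hM) (by positivity)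

/-- Off the end `coord = 0` (a private copy of `AFEnd.coord_of_not_mem` of
`MassCapacityProofs.lean`, which is not imported here). [folklore] -/
private theorem coord_eq_zero_of_not_mem {q : X} (hq : q ∉ e.U) : e.coord q = 0 := by
  classical
  unfold coord
  exact dif_neg hq

/-- **`φ > 0`** (indeed `φ ≥ 1`: `ζ ≥ 0` on `[0, ∞)`).
[cite: SchoenYauPMT1979, §2 Step 1 (p. 49)] -/
theorem syFactor_pos {M σ : ℝ} (hM : M < 0) (q : X) : 0 < e.syFactor M σ q := by
  unfold syFactor
  have h : 0 ≤ syKappa M * (max ‖e.coord q‖ e.R)⁻¹ :=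
    mul_nonneg (syKappa_pos hM).le (inv_nonneg.2 ((norm_nonneg _).trans (le_max_left _ _)))
  linarith [SchoenYau.concaveProfile_nonneg (syT0 M σ) h]

/-- On the end, `φ ∘ Φ = 1 + ζ(κ/r)` (`Φ = dataChart`). [folklore] -/
theorem syFactor_dataChart (M σ : ℝ) (z : exteriorRegion e.R) :
    e.syFactor M σ (e.dataChart z) = syFactorRepr M σ z := by
  unfold syFactor syFactorRepr
  rw [e.coord_dataChart, max_eq_left (le_of_lt (mem_exteriorRegion.1 z.2))]

/-- **Far out `φ = 1 - M/4r`**: for `‖z‖ > 2σ` (`σ > 0`, `M < 0`), `κ/‖z‖ < t₀`, so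
`ζ(κ/‖z‖) = κ/‖z‖` and `φ(Φ z) = 1 - M/(4‖z‖)`. [cite: SchoenYauPMT1979, §2 Step 1 (p. 49)] -/
theorem syFactor_dataChart_of_lt {M σ : ℝ} (hM : M < 0) (hσ : 0 < σ) (z : exteriorRegion e.R)
    (hz : 2 * σ < ‖(z : E3)‖) : e.syFactor M σ (e.dataChart z) = 1 - M / (4 * ‖(z : E3)‖) := by
  rw [e.syFactor_dataChart, syFactorRepr,
    SchoenYau.concaveProfile_of_le (syT0_pos hM hσ)]
  · unfold syKappa; ring
  · unfold syT0
    have hzpos : 0 < ‖(z : E3)‖ := by linarith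
    rw [div_eq_mul_inv]
    exact mul_le_mul_of_nonneg_left ((inv_le_inv₀ hzpos (by positivity)).2 hz.le)
      (syKappa_pos hM).le

/-- Where `κ/max(‖coord q‖, R) ≥ 2 t₀` — in particular wherever `‖coord q‖ ≤ σ` (and off the
end), when `R ≤ σ` — the factor is the constant `1 + ζ(2t₀)`. [folklore] -/
theorem syFactor_eq_const_of_norm_le {M σ : ℝ} (hM : M < 0) (hσ : 0 < σ) (hRσ : e.R ≤ σ) {q : X}
    (hq : ‖e.coord q‖ ≤ σ) :
    e.syFactor M σ q = 1 + SchoenYau.concaveProfile (syT0 M σ) (2 * syT0 M σ) := by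
  unfold syFactor
  rw [SchoenYau.concaveProfile_of_ge (syT0_pos hM hσ)]
  unfold syT0
  have hm : 0 < max ‖e.coord q‖ e.R := lt_max_of_lt_right e.R_pos
  have hmσ : max ‖e.coord q‖ e.R ≤ σ := max_le hq hRσ
  rw [show 2 * (syKappa M / (2 * σ)) = syKappa M * σ⁻¹ by field_simp]
  exact mul_le_mul_of_nonneg_left ((inv_le_inv₀ hσ hm).2 hmσ) (syKappa_pos hM).le

/-- The representative `1 + ζ(κ/‖y‖)` is smooth away from the origin. [folklore] -/
theorem contDiffAt_syFactorRepr (M σ : ℝ) {y : E3} (hy : y ≠ 0) :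
    ContDiffAt ℝ ∞ (syFactorRepr M σ) y := by
  unfold syFactorRepr
  exact contDiffAt_const.add ((SchoenYau.contDiff_concaveProfile _).contDiffAt.comp y
    (contDiffAt_const.mul ((contDiffAt_norm ℝ hy).inv (norm_ne_zero_iff.2 hy))))

variable [IsManifold (𝓡 3) ∞ X]

omit [IsManifold (𝓡 3) ∞ X] in
/-- **`φ` is smooth on `X`** (`R < σ`): on the end it is the smooth radial function
`1 + ζ(κ/‖·‖)` of the smooth coordinate function; off the closed far piece `{‖coord‖ ≥ R₁}`,
`R < R₁ < σ` (an open set, `isClosed_far`), it is locally the constant `1 + ζ(2t₀)`.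
[cite: SchoenYauPMT1979, §2 Step 1 (p. 49)] -/
theorem contMDiff_syFactor {M σ : ℝ} (hM : M < 0) (hRσ : e.R < σ) :
    ContMDiff (𝓡 3) 𝓘(ℝ) ∞ (e.syFactor M σ) := fun q ↦ by
  have hσ : 0 < σ := e.R_pos.trans hRσ
  set R₁ : ℝ := (e.R + σ) / 2 with hR₁
  have hR₁R : e.R < R₁ := by rw [hR₁]; linarith
  have hR₁σ : R₁ < σ := by rw [hR₁]; linarith
  by_cases hq : q ∈ ((↑) : e.U → X) '' (e.chart ⁻¹' {x | R₁ ≤ ‖(x : E3)‖})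
  · -- on the end: `φ = syFactorRepr ∘ coord` near `q`
    obtain ⟨u, -, rfl⟩ := hq
    have hqU : (u : X) ∈ e.U := u.2
    have hev : e.syFactor M σ =ᶠ[𝓝 (u : X)] fun p ↦ syFactorRepr M σ (e.coord p) := by
      filter_upwards [e.U.isOpen.mem_nhds hqU] with p hp
      unfold syFactor syFactorRepr
      rw [max_eq_left (e.lt_norm_coord hp).le]
    refine ContMDiffAt.congr_of_eventuallyEq ?_ hev
    have hc0 : e.coord (u : X) ≠ 0 := by
      intro h0
      have := e.lt_norm_coord hqU
      rw [h0, norm_zero] at this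
      exact lt_irrefl _ (e.R_pos.trans this)
    exact (contDiffAt_syFactorRepr M σ hc0).comp_contMDiffAt (e.contMDiffAt_coord hqU)
  · -- off the closed far piece: locally constant
    have hopen : IsOpen (((↑) : e.U → X) '' (e.chart ⁻¹' {x | R₁ ≤ ‖(x : E3)‖}))ᶜ :=
      (e.isClosed_far R₁ hR₁R).isOpen_compl
    have hev : e.syFactor M σ =ᶠ[𝓝 q]
        fun _ ↦ 1 + SchoenYau.concaveProfile (syT0 M σ) (2 * syT0 M σ) := by
      filter_upwards [hopen.mem_nhds hq] with p hp
      refine e.syFactor_eq_const_of_norm_le hM hσ hRσ.le ?_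
      by_cases hpU : p ∈ e.U
      · by_contra hlt
        rw [not_le] at hlt
        exact hp ⟨⟨p, hpU⟩, by
          show R₁ ≤ ‖(e.chart ⟨p, hpU⟩ : E3)‖
          rw [← e.coord_of_mem hpU]; linarith, rfl⟩
      · rw [e.coord_eq_zero_of_not_mem hpU, norm_zero]
        exact hσ.le
    exact contMDiffAt_const.congr_of_eventuallyEq hev

/-- Off the end, `φ` is locally constant, hence `Δ_h φ = 0` there. [folklore] -/
theorem dalembertian_syFactor_of_not_mem (D : InitialDataSet (𝓡 3) X) [D.metric.HasLeviCivita]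
    {M σ : ℝ} (hM : M < 0) (hRσ : e.R < σ) {q : X} (hq : q ∉ e.U) :
    D.metric.dalembertian (e.syFactor M σ) q = 0 := by
  have hσ : 0 < σ := e.R_pos.trans hRσ
  set R₁ : ℝ := (e.R + σ) / 2 with hR₁
  have hR₁R : e.R < R₁ := by rw [hR₁]; linarith
  have hR₁σ : R₁ < σ := by rw [hR₁]; linarith
  have hq' : q ∉ ((↑) : e.U → X) '' (e.chart ⁻¹' {x | R₁ ≤ ‖(x : E3)‖}) := by
    rintro ⟨u, -, rfl⟩
    exact hq u.2
  have hopen : IsOpen (((↑) : e.U → X) '' (e.chart ⁻¹' {x | R₁ ≤ ‖(x : E3)‖}))ᶜ :=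
    (e.isClosed_far R₁ hR₁R).isOpen_compl
  have hev : e.syFactor M σ =ᶠ[𝓝 q]
      fun _ ↦ 1 + SchoenYau.concaveProfile (syT0 M σ) (2 * syT0 M σ) := by
    filter_upwards [hopen.mem_nhds hq'] with p hp
    refine e.syFactor_eq_const_of_norm_le hM hσ hRσ.le ?_
    by_cases hpU : p ∈ e.U
    · by_contra hlt
      rw [not_le] at hlt
      exact hp ⟨⟨p, hpU⟩, by
        show R₁ ≤ ‖(e.chart ⟨p, hpU⟩ : E3)‖
        rw [← e.coord_of_mem hpU]; linarith, rfl⟩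
    · rw [e.coord_eq_zero_of_not_mem hpU, norm_zero]
      exact hσ.le
  exact D.metric.dalembertian_eq_zero_of_eventuallyEq hev

/-! ### (2.3): the Laplacian of `φ` in the chart of the end -/

section Laplacian

variable (D : InitialDataSet (𝓡 3) X) [D.metric.HasLeviCivita]

omit [D.metric.HasLeviCivita] in
/-- The chart components are positive semidefinite: `h_ij(z) uⁱ uʲ = h(dΦ u, dΦ u) ≥ 0`.
[folklore] -/
theorem hCoeff_apply_self_nonneg (z : exteriorRegion e.R) (u : E3) : 0 ≤ hCoeff e D z u u := by
  rw [e.hCoeff_apply_eq_metric_dataChart D z u]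
  set v := mfderiv (𝓡 3) (𝓡 3) e.dataChart z u
  by_cases hv : v = 0
  · rw [hv]; simp
  · exact (D.isRiemannian_metric _ v hv).le

/-- The profile read through `κ`: `g(t) = 1 + ζ(κ t)` is `C^∞`, with `g'(t) = κ ζ'(κt)` and
`g''(t) = κ² ζ''(κ t)`. [folklore] -/
theorem deriv_syProfile (M σ t : ℝ) :
    deriv (fun s ↦ 1 + SchoenYau.concaveProfile (syT0 M σ) (syKappa M * s)) t =
      syKappa M * deriv (SchoenYau.concaveProfile (syT0 M σ)) (syKappa M * t) := by
  rw [deriv_const_add, deriv_comp_mul_left (c := syKappa M)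
    (f := SchoenYau.concaveProfile (syT0 M σ)) (x := t), smul_eq_mul]

/-- `g''(t) = κ² ζ''(κ t)` for `g(t) = 1 + ζ(κ t)`. [folklore] -/
theorem deriv_deriv_syProfile (M σ t : ℝ) :
    deriv (deriv fun s ↦ 1 + SchoenYau.concaveProfile (syT0 M σ) (syKappa M * s)) t =
      syKappa M ^ 2
        * deriv (deriv (SchoenYau.concaveProfile (syT0 M σ))) (syKappa M * t) := by
  have h : deriv (fun s ↦ 1 + SchoenYau.concaveProfile (syT0 M σ) (syKappa M * s)) =
      fun s ↦ syKappa M * deriv (SchoenYau.concaveProfile (syT0 M σ)) (syKappa M * s) :=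
    funext fun s ↦ deriv_syProfile M σ s
  have hd : DifferentiableAt ℝ
      (fun s ↦ SchoenYau.profileCutoff (syT0 M σ) (syKappa M * s)) t :=
    ((SchoenYau.contDiff_profileCutoff _).differentiable (by simp) _).comp t
      ((differentiableAt_const _).mul differentiableAt_id)
  rw [h, SchoenYau.deriv_concaveProfile, deriv_const_mul _ hd,
    deriv_comp_mul_left (c := syKappa M) (f := SchoenYau.profileCutoff (syT0 M σ)) (x := t),
    smul_eq_mul]
  ring

/-- `s ↦ 1 + ζ(κ s)` is smooth. [folklore] -/
theorem contDiff_syProfile (M σ : ℝ) :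
    ContDiff ℝ ∞ fun s ↦ 1 + SchoenYau.concaveProfile (syT0 M σ) (syKappa M * s) :=
  contDiff_const.add ((SchoenYau.contDiff_concaveProfile _).comp (contDiff_const.mul contDiff_id))

/-- **Schoen–Yau (2.3) in the chart of the end.** For `z` in the exterior region,
`Δ_h φ (Φ z) = κ ζ'(κ/‖z‖) Δ_G(1/r)(z) + κ² ζ''(κ/‖z‖) |∇(1/r)|²_G(z)`, where `G = hCoeff e D` are
the chart components, `Δ_G = lapAt` and `|∇u|²_G = Du(♯Du)`: naturality of `□` under the chart
(`dalembertian_comap`), the chart formula `OpensChart.dalembertian_eq_lapAt`, and the chain rule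
`MetricCoord.lapAt_comp`. [cite: SchoenYauPMT1979, §2 Step 1, (2.3) (p. 49)] -/
theorem dalembertian_syFactor_dataChart {M σ : ℝ} (hM : M < 0) (hRσ : e.R < σ)
    (z : exteriorRegion e.R) :
    D.metric.dalembertian (e.syFactor M σ) (e.dataChart z) =
      syKappa M * deriv (SchoenYau.concaveProfile (syT0 M σ)) (syKappa M * ‖(z : E3)‖⁻¹)
          * MetricCoord.lapAt (hCoeff e D) (fun y : E3 ↦ ‖y‖⁻¹) z
        + syKappa M ^ 2
          * deriv (deriv (SchoenYau.concaveProfile (syT0 M σ))) (syKappa M * ‖(z : E3)‖⁻¹)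
          * fderiv ℝ (fun y : E3 ↦ ‖y‖⁻¹) z
              (MetricCoord.sharpAt (hCoeff e D) z (fderiv ℝ (fun y : E3 ↦ ‖y‖⁻¹) z)) := by
  -- the pullback metric on the exterior region and naturality of `□`
  set γ := D.metric.comap PseudoRiemannianMetric.contMDiff_pullbackBilin_holds e.dataChart
    e.contMDiff_dataChart_succ e.injective_mfderiv_dataChart rfl with hγ
  haveI : γ.HasLeviCivita := γ.hasLeviCivita
  have hz0 : (z : E3) ≠ 0 := by
    intro h
    have := z.2
    rw [mem_exteriorRegion, h, norm_zero] at this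
    exact lt_irrefl _ (e.R_pos.trans this)
  have hsm : ContMDiffAt (𝓡 3) 𝓘(ℝ) 2 (e.syFactor M σ) (e.dataChart z) :=
    ((e.contMDiff_syFactor hM hRσ) _).of_le (by exact_mod_cast natCast_le_infty 2)
  have hnat := D.metric.dalembertian_comap PseudoRiemannianMetric.contMDiff_pullbackBilin_holds
    e.contMDiff_dataChart_succ e.injective_mfderiv_dataChart rfl hsm
  rw [← hnat]
  -- the chart formula with the representative `1 + ζ(κ/‖·‖)`
  have hrepr : ∀ y : exteriorRegion e.R, (e.syFactor M σ ∘ e.dataChart) y = syFactorRepr M σ y :=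
    fun y ↦ e.syFactor_dataChart M σ y
  rw [OpensChart.dalembertian_eq_lapAt (e.val_comap_dataChart D) z hrepr
    ((contDiffAt_syFactorRepr M σ hz0).of_le (by exact_mod_cast natCast_le_infty 2))]
  -- the chain rule
  have hu : ContDiffAt ℝ 2 (fun y : E3 ↦ ‖y‖⁻¹) z :=
    (contDiffAt_norm ℝ hz0).inv (norm_ne_zero_iff.2 hz0)
  have h := MetricCoord.lapAt_comp (G := hCoeff e D) (y := (z : E3))
    ((contDiff_syProfile M σ).of_le (by exact_mod_cast natCast_le_infty 2)) hu
  unfold syFactorRepr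
  rw [h, deriv_syProfile, deriv_deriv_syProfile]

/-- **Schoen–Yau (2.3): `Δφ ≤ 0` on the end**, for `σ` at least the radius of (2.1) (and
`σ > R`): if `‖z‖ > σ` then `Δ_G(1/r)(z) < 0` and `ζ' ≥ 0`; if `‖z‖ ≤ σ` then `κ/‖z‖ ≥ 2t₀` and
`ζ'(κ/‖z‖) = 0`; in both cases `ζ'' ≤ 0` and `|∇(1/r)|² ≥ 0`.
[cite: SchoenYauPMT1979, §2 Step 1, (2.3) (p. 49)] -/
theorem dalembertian_syFactor_dataChart_nonpos {M σ : ℝ} (hM : M < 0) (hRσ : e.R < σ)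
    (hσ : ∀ y : E3, σ ≤ ‖y‖ → MetricCoord.lapAt (hCoeff e D) (fun w : E3 ↦ ‖w‖⁻¹) y < 0)
    (z : exteriorRegion e.R) :
    D.metric.dalembertian (e.syFactor M σ) (e.dataChart z) ≤ 0 := by
  have hσpos : 0 < σ := e.R_pos.trans hRσ
  have ht₀ := syT0_pos hM hσpos
  have hκ := syKappa_pos hM
  rw [e.dalembertian_syFactor_dataChart D hM hRσ z]
  have hzpos : 0 < ‖(z : E3)‖ := e.R_pos.trans (mem_exteriorRegion.1 z.2)
  -- the second term is `≤ 0`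
  have h2 : syKappa M ^ 2
      * deriv (deriv (SchoenYau.concaveProfile (syT0 M σ))) (syKappa M * ‖(z : E3)‖⁻¹)
      * fderiv ℝ (fun y : E3 ↦ ‖y‖⁻¹) z
          (MetricCoord.sharpAt (hCoeff e D) z (fderiv ℝ (fun y : E3 ↦ ‖y‖⁻¹) z)) ≤ 0 := by
    have ha : 0 ≤ syKappa M ^ 2 := sq_nonneg _
    have hb : deriv (deriv (SchoenYau.concaveProfile (syT0 M σ))) (syKappa M * ‖(z : E3)‖⁻¹)
        ≤ 0 := SchoenYau.deriv_deriv_concaveProfile_nonpos ht₀ _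
    have hc : 0 ≤ fderiv ℝ (fun y : E3 ↦ ‖y‖⁻¹) z
        (MetricCoord.sharpAt (hCoeff e D) z (fderiv ℝ (fun y : E3 ↦ ‖y‖⁻¹) z)) :=
      MetricCoord.apply_sharpAt_self_nonneg
        (OpensChart.isInvertible_repr (e.val_comap_dataChart D) z)
        (e.hCoeff_apply_self_nonneg D z) _
    exact mul_nonpos_of_nonpos_of_nonneg (mul_nonpos_of_nonneg_of_nonpos ha hb) hc
  -- the first term is `≤ 0`
  have h1 : syKappa M * deriv (SchoenYau.concaveProfile (syT0 M σ)) (syKappa M * ‖(z : E3)‖⁻¹)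
      * MetricCoord.lapAt (hCoeff e D) (fun y : E3 ↦ ‖y‖⁻¹) z ≤ 0 := by
    by_cases hzσ : σ ≤ ‖(z : E3)‖
    · have hl := hσ z hzσ
      have hd : 0 ≤ deriv (SchoenYau.concaveProfile (syT0 M σ)) (syKappa M * ‖(z : E3)‖⁻¹) :=
        SchoenYau.deriv_concaveProfile_nonneg _ _
      exact mul_nonpos_of_nonneg_of_nonpos (mul_nonneg hκ.le hd) hl.le
    · rw [not_le] at hzσ
      have hge : 2 * syT0 M σ ≤ syKappa M * ‖(z : E3)‖⁻¹ := by
        unfold syT0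
        rw [show 2 * (syKappa M / (2 * σ)) = syKappa M * σ⁻¹ by field_simp]
        exact mul_le_mul_of_nonneg_left ((inv_le_inv₀ hσpos hzpos).2 hzσ.le) hκ.le
      rw [SchoenYau.deriv_concaveProfile_of_ge ht₀ hge, mul_zero, zero_mul]
  linarith

/-- **Schoen–Yau (2.3): `Δφ < 0` for `r > 2σ`**: there `κ/‖z‖ < t₀`, so `ζ' = 1`, `ζ'' = 0` and
`Δφ = κ Δ_G(1/r) < 0`. [cite: SchoenYauPMT1979, §2 Step 1, (2.3) (p. 49)] -/
theorem dalembertian_syFactor_dataChart_neg {M σ : ℝ} (hM : M < 0) (hRσ : e.R < σ)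
    (hσ : ∀ y : E3, σ ≤ ‖y‖ → MetricCoord.lapAt (hCoeff e D) (fun w : E3 ↦ ‖w‖⁻¹) y < 0)
    (z : exteriorRegion e.R) (hz : 2 * σ < ‖(z : E3)‖) :
    D.metric.dalembertian (e.syFactor M σ) (e.dataChart z) < 0 := by
  have hσpos : 0 < σ := e.R_pos.trans hRσ
  have ht₀ := syT0_pos hM hσpos
  have hκ := syKappa_pos hM
  have hzpos : 0 < ‖(z : E3)‖ := e.R_pos.trans (mem_exteriorRegion.1 z.2)
  rw [e.dalembertian_syFactor_dataChart D hM hRσ z]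
  have hlt : syKappa M * ‖(z : E3)‖⁻¹ < syT0 M σ := by
    unfold syT0
    rw [div_eq_mul_inv]
    exact mul_lt_mul_of_pos_left ((inv_lt_inv₀ hzpos (by positivity)).2 hz) hκ
  rw [SchoenYau.deriv_concaveProfile_of_le ht₀ hlt.le,
    SchoenYau.deriv_deriv_concaveProfile_of_lt ht₀ hlt, mul_one, mul_zero, zero_mul, add_zero]
  exact mul_neg_of_pos_of_neg hκ (hσ z (by linarith))

end Laplacian

/-! ### Assembly: the hypothesis `hfac`, and Step 1 discharged -/

omit [IsManifold (𝓡 3) ∞ X] in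
/-- Every point of `X` is either off the end or in the image of `dataChart`. [folklore] -/
theorem eq_dataChart_or_not_mem (q : X) :
    (∃ z : exteriorRegion e.R, e.dataChart z = q) ∨ q ∉ e.U := by
  by_cases hq : q ∈ e.U
  · exact Or.inl ⟨⟨e.coord q, e.lt_norm_coord hq⟩, e.dataChart_coord hq⟩
  · exact Or.inr hq

end AFEnd

/-- **The superharmonic conformal factor of Schoen–Yau's Step 1** — the hypothesis `hfac` of
`exists_conformal_scalarPos_of_massNeg_of_ingredients`, **proved**: on initial data whose end `e`
has the expansion (1.1) with mass `M < 0`, there are a smooth positive `φ` on `X` and a radius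
`ρ ≥ R` with `Δ_h φ ≤ 0` on `X`, `Δ_h φ < 0` on `far ρ`, and `φ(Φ y) = 1 - M/(4‖y‖)` for
`‖y‖ > ρ` — namely `φ = AFEnd.syFactor e M σ`, `ρ = 2σ`, with `σ` beyond `R` and the radius of
(2.1) (`AFEnd.exists_radius_lapAt_hCoeff_inv_norm_le`). Schoen–Yau 1979, §2 Step 1,
(2.1)–(2.3), pp. 48–49. [cite: SchoenYauPMT1979, §2 Step 1, (2.1)–(2.3) (pp. 48–49)] -/
theorem superharmonicFactor_of_massNeg :
    ∀ (X : Type) [TopologicalSpace X] [ChartedSpace E3 X] [IsManifold (𝓡 3) ∞ X]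
      [T2Space X] [SecondCountableTopology X] [ConnectedSpace X]
      (D : InitialDataSet (𝓡 3) X) [D.metric.HasLeviCivita] (e : AFEnd X) (M : ℝ),
      IsAsymptoticallySchwarzschild e D M 2 → M < 0 →
      ∃ (φ : X → ℝ) (ρ : ℝ), e.R ≤ ρ ∧ ContMDiff (𝓡 3) 𝓘(ℝ) ∞ φ ∧ (∀ x : X, 0 < φ x) ∧
        (∀ x : X, D.metric.dalembertian φ x ≤ 0) ∧
        (∀ x ∈ e.far ρ, D.metric.dalembertian φ x < 0) ∧
        ∀ y : exteriorRegion e.R, ρ < ‖(y : E3)‖ →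
          φ (e.dataChart y) = 1 - M / (4 * ‖(y : E3)‖) := by
  intro X _ _ _ _ _ _ D _ e M hAS hM
  obtain ⟨σ₀, hσ₀R, hσ₀⟩ := e.exists_radius_lapAt_hCoeff_inv_norm_le D hAS hM
  set σ : ℝ := max σ₀ (e.R + 1) with hσdef
  have hRσ : e.R < σ := lt_of_lt_of_le (by linarith) (le_max_right _ _)
  have hσpos : 0 < σ := e.R_pos.trans hRσ
  have hσ : ∀ y : E3, σ ≤ ‖y‖ → MetricCoord.lapAt (AFEnd.hCoeff e D) (fun w : E3 ↦ ‖w‖⁻¹) y < 0 :=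
    fun y hy ↦ (hσ₀ y ((le_max_left _ _).trans hy)).2
  refine ⟨e.syFactor M σ, 2 * σ, by linarith, e.contMDiff_syFactor hM hRσ,
    e.syFactor_pos hM, fun x ↦ ?_, fun x hx ↦ ?_,
    fun y hy ↦ e.syFactor_dataChart_of_lt hM hσpos y hy⟩
  · rcases e.eq_dataChart_or_not_mem x with ⟨z, rfl⟩ | hx
    · exact e.dalembertian_syFactor_dataChart_nonpos D hM hRσ hσ z
    · exact (e.dalembertian_syFactor_of_not_mem D hM hRσ hx).le
  · obtain ⟨z, hz, rfl⟩ := e.mem_far_iff.1 hx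
    exact e.dalembertian_syFactor_dataChart_neg D hM hRσ hσ z hz

/-- **Step 1 of the proof of Schoen–Yau's Theorem 1, discharged.** The named fact
`exists_conformal_scalarPos_of_massNeg` (`PositiveMassSchoenYau.lean`; Schoen–Yau, Comm. Math.
Phys. 65 (1979), §2 Step 1, pp. 48–49: if the mass of the end is negative, a conformal metric
`φ⁴ ds²` with the expansion (1.1), negative mass, `R ≥ 0` everywhere and `R > 0` outside a compact
set) follows from its two printed ingredients, both now theorems: the conformal transformation
law `R(φ⁴g) = φ⁻⁵(R(g)φ − 8Δ_g φ)` (`conformal_scalarCurvature_law`, `ConformalChange.lean`) and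
the superharmonic factor (2.1)–(2.3) (`superharmonicFactor_of_massNeg`), through the proved
reduction `exists_conformal_scalarPos_of_massNeg_of_ingredients`
(`PositiveMassConformalProofs.lean`). [cite: SchoenYauPMT1979, §2 Step 1 (pp. 48–49)] -/
theorem exists_conformal_scalarPos_of_massNeg_holds : exists_conformal_scalarPos_of_massNeg :=
  exists_conformal_scalarPos_of_massNeg_of_ingredients conformal_scalarCurvature_law
    superharmonicFactor_of_massNeg

end Literature.Geometry.Lorentzian

end
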